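import Literature.AlgebraicGeometry.Motives.MixedHodgeStructureCatWeightSerreClasses
import Literature.AlgebraicGeometry.Motives.MixedHodgeStructureCatTateTwist
import Literature.AlgebraicGeometry.Motives.MixedHodgeStructureTensorGr
import Literature.AlgebraicGeometry.Motives.MixedHodgeStructureInternalHom
import HarnessLib

/-!
# Weights of tensor products, duals, internal Homs and Tate twists of mixed Hodge structures

Layer `Literature/AlgebraicGeometry/Motives` (lane `lit-hodgefound`), continuing `Motives/MixedHodgeStructureCatWeightSerreClasses` (g44-#1,
`weightsIn S`).  The tree constructs the tensor product `H₁ ⊗ H₂` (`MixedHodgeStructure.tensor`, `W_n(H₁ ⊗ H₂) = Σ_{i+j=n} W_i ⊗ W_j`,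
`Motives/MixedHodgeStructureTensor`), the dual `H^∨` (`MixedHodgeStructure.dual`, `W_r(H^∨) = (W_{-r-1})^⊥`, `Motives/MixedHodgeStructureDual`),
the internal Hom `Hom(H₁, H₂) = H₁^∨ ⊗ H₂` (`MixedHodgeStructure.hom`, `Motives/MixedHodgeStructureInternalHom`) and the Tate twists
`H(j)` (`MixedHodgeStructure.tateTwist`, the functor `MixedHodgeStructureCat.tateTwist`), together with Deligne's isomorphisms
`⊕_{i+j=n} Gr^W_i H₁ ⊗ Gr^W_j H₂ ⥲ Gr^W_n(H₁ ⊗ H₂)` (`tensorGrMap`, `iSup_range_tensorGrMap_eq_top`, `tensorGrMap_injective`,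
`Motives/MixedHodgeStructureTensorGr`) and `Gr^W_k(H^∨) ≅ (Gr^W_{-k} H)^∨` (`isWeight_dual_iff`, `Motives/MixedHodgeStructureDualHodgeNumbers`).
Here we draw the consequences for the WEIGHTS (Deligne, *Hodge II*, 1.1.12; Cattani–El Zein–Griffiths–Lê §3.2.2.7 (1) and Ex. 3.2.23 (4)):
**the weights of `H₁ ⊗ H₂` are exactly the sums of a weight of `H₁` and a weight of `H₂`** (`isWeight_tensor_iff`,
`setOf_isWeight_tensor`), the weights of `H^∨` are the negatives (`setOf_isWeight_dual`), the weights of `Hom(H₁, H₂)` are the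
differences (`isWeight_hom_iff`, `setOf_isWeight_hom`), the weights of `H(j)` are shifted by `-2j`; and the corresponding rules for the
classes `weightsIn S` of g44-#1 (Minkowski sum, negation, difference, shift) with their interval forms (`weights ≤ a ⊗ weights ≤ b ⊆
weights ≤ a + b`, `Hom(weights ≥ a, weights ≤ b) ⊆ weights ≤ b - a`, …).  Everything is PROVED; no named fact is introduced
(`HodgeTensorFacts` is the tree's DISCHARGED class, `hodgeTensorFacts_holds`).

Sources, verbatim.  P. Deligne, *Théorie de Hodge II*, Publ. Math. IHÉS 40 (1971) [DeligneHodgeII1971], 1.1.12 (filtered tensor products: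
`W_n(A ⊗ B) = Σ_{i+j=n} W_i A ⊗ W_j B`, the evident morphisms `⊗ Gr(A_i) → Gr(⊗ A_i)` «sont des isomorphismes»; not held, cited through
the tree's `Motives/MixedHodgeStructureTensorGr`).  E. Cattani, F. El Zein, P. A. Griffiths, Lê D. T. (eds.), *Hodge Theory* (2014)
[CattaniElZeinGriffithsLe2014] (held text `book:cattani2014-hodge-theory-princeton-mathematical-notes-49`), §3.2.2.7 (1) (p0163) «`W_r(H ⊗ H')
= Σ_{p+p'=r} W_p ⊗ W_{p'}`»; Ex. 3.2.23 (4) (p0163) «`W_r H(m) := W_{r+2m} H`, `F^r H(m) := F^{r+m} H`» and «its `m`-twist is an HS of weight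
`n − 2m`» (Ex. 3.1.5, p0132).  A. Fujiki, *Duality of mixed Hodge structures of algebraic varieties*, Publ. RIMS 16 (1980) [Fujiki1980],
(1.6.2) a) (the dual MHS `W_k(H^∨) = (W_{-k-1} H)^⊥`; cited through the tree's `Motives/MixedHodgeStructureDualHodgeNumbers`).

## Main definitions and results

* §1 (unbundled, `MixedHodgeStructure`) **`isWeight_tensor_iff`** (`(H₁ ⊗ H₂).IsWeight n ↔ ∃ i j, i + j = n ∧ H₁.IsWeight i ∧
  H₂.IsWeight j`), `setOf_isWeight_tensor` (`= S₁ + S₂`), `tensor_W_eq_top_of_W_eq_top`, `tensor_W_eq_bot_of_W_eq_bot`;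
  `setOf_isWeight_dual` (`= -S`), `dual_W_eq_top_iff`, `dual_W_eq_bot_iff`; **`isWeight_hom_iff`**, `setOf_isWeight_hom`,
  `hom_W_eq_top_of`, `hom_W_eq_bot_of`.
* §2 (bundled, `MixedHodgeStructureCat`) `weightsIn_tensor` (`X ∈ weightsIn S`, `Y ∈ weightsIn T ⟹ X ⊗ Y ∈ weightsIn (S + T)`), interval
  forms `weightsIn_Iic_tensor`, `weightsIn_Ici_tensor`, `weightsIn_Icc_tensor`, `weightsIn_singleton_tensor`; `weightsIn_dual_iff`
  (`X^∨ ∈ weightsIn S ↔ X ∈ weightsIn (-S)`), `weightsIn_Iic_dual_iff`, `weightsIn_Ici_dual_iff`, `weightsIn_singleton_dual_iff`;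
  `weightsIn_hom` (`Hom(X, Y) ∈ weightsIn (image2 (j - i))`), `weightsIn_Iic_hom`, `weightsIn_Ici_hom`, `weightsIn_Icc_hom`,
  `weightsIn_singleton_hom`; `weightsIn_tateTwist_obj_iff` (`X(j) ∈ weightsIn S ↔ X ∈ weightsIn ((· - 2j) ⁻¹' S)`),
  `weightsIn_Iic_tateTwist_obj_iff`, `weightsIn_Ici_tateTwist_obj_iff`, `weightsIn_singleton_tateTwist_obj_iff`.

## References

* [DeligneHodgeII1971] P. Deligne, Théorie de Hodge II, Publ. Math. IHÉS 40 (1971), 1.1.12, 2.3.1.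
* [CattaniElZeinGriffithsLe2014] E. Cattani, F. El Zein, P. A. Griffiths, Lê D. T. (eds.), Hodge Theory, Princeton Math. Notes 49 (2014),
  §3.2.2.7, Ex. 3.1.5, Ex. 3.2.23.
* [Fujiki1980] A. Fujiki, Duality of mixed Hodge structures of algebraic varieties, Publ. RIMS Kyoto Univ. 16 (1980), (1.6.2).

## Provenance

Lane `lit-hodgefound` (summit `HodgeConjecture`), seat `lit-hodgefound-p36` (literature-prover, generation 44, row g44-#3).
-/

noncomputable section

open CategoryTheory CategoryTheory.Limits
open scoped TensorProduct Pointwise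

namespace Literature.AlgebraicGeometry.Motives

universe u

/-! ## §1 Weights of `H₁ ⊗ H₂`, `H^∨`, `Hom(H₁, H₂)` (unbundled) -/

namespace MixedHodgeStructure

variable {V : Type u} [AddCommGroup V] [Module ℚ V] {V' : Type u} [AddCommGroup V'] [Module ℚ V']
variable [FiniteDimensional ℚ V] [FiniteDimensional ℚ V'] (H₁ : MixedHodgeStructure V) (H₂ : MixedHodgeStructure V')

/-- A tensor product of finite-dimensional `ℚ`-vector spaces is non-trivial iff both factors are (`dim (M ⊗ N) = dim M · dim N`).
[folklore] -/
private theorem nontrivial_tensorProduct_iff (M N : Type u) [AddCommGroup M] [Module ℚ M] [AddCommGroup N] [Module ℚ N]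
    [FiniteDimensional ℚ M] [FiniteDimensional ℚ N] : Nontrivial (M ⊗[ℚ] N) ↔ Nontrivial M ∧ Nontrivial N := by
  rw [← Module.finrank_pos_iff (R := ℚ), ← Module.finrank_pos_iff (R := ℚ), ← Module.finrank_pos_iff (R := ℚ),
    Module.finrank_tensorProduct]
  exact CanonicallyOrderedAdd.mul_pos

/-- **The weights of `H₁ ⊗ H₂` are the sums of a weight of `H₁` and a weight of `H₂`**: `Gr^W_n(H₁ ⊗ H₂) ≠ 0` iff
`Gr^W_i H₁ ⊗ Gr^W_j H₂ ≠ 0` for some `i + j = n` (Deligne's isomorphism `⊕_{i+j=n} Gr^W_i H₁ ⊗ Gr^W_j H₂ ⥲ Gr^W_n(H₁ ⊗ H₂)`).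
[cite: DeligneHodgeII1971, 1.1.12] [cite: CattaniElZeinGriffithsLe2014, §3.2.2.7] -/
theorem isWeight_tensor_iff (n : ℤ) : (tensor H₁ H₂).IsWeight n ↔ ∃ i j : ℤ, i + j = n ∧ H₁.IsWeight i ∧ H₂.IsWeight j := by
  constructor
  · intro hn
    by_contra hne
    push Not at hne
    obtain ⟨a, ha⟩ := H₁.exists_W_eq_bot
    obtain ⟨b, hb⟩ := H₁.exists_W_eq_top
    have htop := iSup_range_tensorGrMap_eq_top H₁ H₂ n (a := a + 1) (b := b) (by rwa [add_sub_cancel_right]) hb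
    have hbot : ∀ i ∈ Finset.Icc (a + 1) b, LinearMap.range (tensorGrMap H₁ H₂ n i (n - i) (by omega)) = ⊥ := by
      intro i _
      have hs : Subsingleton (grW H₁.W i ⊗[ℚ] grW H₂.W (n - i)) := by
        rw [← not_nontrivial_iff_subsingleton, nontrivial_tensorProduct_iff, not_and_or, not_nontrivial_iff_subsingleton,
          not_nontrivial_iff_subsingleton, subsingleton_grW_iff_not_isWeight, subsingleton_grW_iff_not_isWeight]
        by_contra h
        push Not at h
        exact hne i (n - i) (by omega) h.1 h.2
      exact LinearMap.range_eq_bot.2 (LinearMap.ext fun x => by rw [Subsingleton.elim x 0, map_zero, LinearMap.zero_apply])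
    have htop' : (⊤ : Submodule ℚ (grW (tensor H₁ H₂).W n)) = ⊥ := by
      rw [← htop]
      exact le_bot_iff.1 (iSup₂_le fun i hi => (hbot i hi).le)
    have hsub : Subsingleton (grW (tensor H₁ H₂).W n) :=
      ⟨fun x y => by
        have hx : x ∈ (⊥ : Submodule ℚ _) := htop' ▸ Submodule.mem_top
        have hy : y ∈ (⊥ : Submodule ℚ _) := htop' ▸ Submodule.mem_top
        rw [(Submodule.mem_bot ℚ).1 hx, (Submodule.mem_bot ℚ).1 hy]⟩
    exact (subsingleton_grW_iff_not_isWeight _ n).1 hsub hn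
  · rintro ⟨i, j, hij, hi, hj⟩
    have h1 : Nontrivial (grW H₁.W i) := not_subsingleton_iff_nontrivial.1 fun h => (subsingleton_grW_iff_not_isWeight H₁ i).1 h hi
    have h2 : Nontrivial (grW H₂.W j) := not_subsingleton_iff_nontrivial.1 fun h => (subsingleton_grW_iff_not_isWeight H₂ j).1 h hj
    have h12 : Nontrivial (grW H₁.W i ⊗[ℚ] grW H₂.W j) := (nontrivial_tensorProduct_iff _ _).2 ⟨h1, h2⟩
    have hinj := tensorGrMap_injective H₁ H₂ n i j hij
    by_contra hn
    have hs : Subsingleton (grW (tensor H₁ H₂).W n) := (subsingleton_grW_iff_not_isWeight _ n).2 hn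
    exact not_subsingleton_iff_nontrivial.2 h12 (hinj.subsingleton)

/-- **The set of weights of `H₁ ⊗ H₂` is the Minkowski sum of the sets of weights of `H₁` and `H₂`.**
[cite: DeligneHodgeII1971, 1.1.12] [cite: CattaniElZeinGriffithsLe2014, §3.2.2.7] -/
theorem setOf_isWeight_tensor : {n | (tensor H₁ H₂).IsWeight n} = {i | H₁.IsWeight i} + {j | H₂.IsWeight j} := by
  ext n
  rw [Set.mem_setOf_eq, isWeight_tensor_iff, Set.mem_add]
  constructor
  · rintro ⟨i, j, h, hi, hj⟩
    exact ⟨i, hi, j, hj, h⟩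
  · rintro ⟨i, hi, j, hj, h⟩
    exact ⟨i, j, h, hi, hj⟩

/-- **`W_{a+b}(H₁ ⊗ H₂) = H₁ ⊗ H₂` when `W_a H₁ = H₁` and `W_b H₂ = H₂`** (weights `≤ a` times weights `≤ b` have weights `≤ a + b`).
[cite: DeligneHodgeII1971, 1.1.12] [cite: CattaniElZeinGriffithsLe2014, §3.2.2.7] -/
theorem tensor_W_eq_top_of_W_eq_top {a b : ℤ} (ha : H₁.W a = ⊤) (hb : H₂.W b = ⊤) : (tensor H₁ H₂).W (a + b) = ⊤ := by
  refine weightsLE_iff.1 (weightsLE_of_forall_isWeight fun n hn => ?_)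
  obtain ⟨i, j, hij, hi, hj⟩ := (isWeight_tensor_iff H₁ H₂ n).1 hn
  have hi' := (weightsLE_iff.2 ha).le_of_isWeight hi
  have hj' := (weightsLE_iff.2 hb).le_of_isWeight hj
  omega

/-- **`W_{a+b+1}(H₁ ⊗ H₂) = 0` when `W_a H₁ = 0` and `W_b H₂ = 0`** (weights `> a` times weights `> b` have weights `> a + b + 1`).
[cite: DeligneHodgeII1971, 1.1.12] [cite: CattaniElZeinGriffithsLe2014, §3.2.2.7] -/
theorem tensor_W_eq_bot_of_W_eq_bot {a b : ℤ} (ha : H₁.W a = ⊥) (hb : H₂.W b = ⊥) : (tensor H₁ H₂).W (a + b + 1) = ⊥ := by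
  refine MixedHodgeStructureCat.W_eq_bot_of_forall_isWeight_lt (X := MixedHodgeStructureCat.of (tensor H₁ H₂)) fun n hn => ?_
  obtain ⟨i, j, hij, hi, hj⟩ := (isWeight_tensor_iff H₁ H₂ n).1 hn
  have hi' : a < i := lt_of_not_ge fun h => not_isWeight_of_W_eq_bot ha h hi
  have hj' : b < j := lt_of_not_ge fun h => not_isWeight_of_W_eq_bot hb h hj
  omega

/-- **The set of weights of `H^∨` is the negative of the set of weights of `H`.** [cite: Fujiki1980, (1.6.2) a)] -/
theorem setOf_isWeight_dual : {k | H₁.dual.IsWeight k} = -{k | H₁.IsWeight k} := by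
  ext k
  rw [Set.mem_setOf_eq, isWeight_dual_iff, Set.mem_neg, Set.mem_setOf_eq]

/-- `W_r(H^∨) = H^∨` iff `W_{-r-1} H = 0` (`W_r(H^∨) = (W_{-r-1} H)^⊥`). [cite: Fujiki1980, (1.6.2) a)] -/
theorem dual_W_eq_top_iff (r : ℤ) : H₁.dual.W r = ⊤ ↔ H₁.W (-r - 1) = ⊥ := by
  rw [dual_W, Submodule.dualAnnihilator_eq_top_iff]

/-- `W_r(H^∨) = 0` iff `W_{-r-1} H = H`. [cite: Fujiki1980, (1.6.2) a)] -/
theorem dual_W_eq_bot_iff (r : ℤ) : H₁.dual.W r = ⊥ ↔ H₁.W (-r - 1) = ⊤ := by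
  rw [dual_W, Submodule.dualAnnihilator_eq_bot_iff]

/-- **The weights of `Hom(H₁, H₂)` are the differences `j - i` of a weight `j` of `H₂` and a weight `i` of `H₁`**
(`Hom(H₁, H₂) = H₁^∨ ⊗ H₂`). [cite: DeligneHodgeII1971, 1.1.12] [cite: CattaniElZeinGriffithsLe2014, §3.2.2.7] -/
theorem isWeight_hom_iff (n : ℤ) : (hom H₁ H₂).IsWeight n ↔ ∃ i j : ℤ, j - i = n ∧ H₁.IsWeight i ∧ H₂.IsWeight j := by
  rw [hom, isWeight_comapEquiv_iff, isWeight_tensor_iff]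
  constructor
  · rintro ⟨i, j, h, hi, hj⟩
    exact ⟨-i, j, by omega, (isWeight_dual_iff H₁ i).1 hi, hj⟩
  · rintro ⟨i, j, h, hi, hj⟩
    exact ⟨-i, j, by omega, (isWeight_dual_iff H₁ (-i)).2 (by rwa [neg_neg]), hj⟩

/-- **The set of weights of `Hom(H₁, H₂)` is `{j - i}`** (weights of `H₂` minus weights of `H₁`).
[cite: DeligneHodgeII1971, 1.1.12] [cite: CattaniElZeinGriffithsLe2014, §3.2.2.7] -/
theorem setOf_isWeight_hom : {n | (hom H₁ H₂).IsWeight n} = Set.image2 (fun i j => j - i) {i | H₁.IsWeight i} {j | H₂.IsWeight j} := by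
  ext n
  rw [Set.mem_setOf_eq, isWeight_hom_iff, Set.mem_image2]
  constructor
  · rintro ⟨i, j, h, hi, hj⟩
    exact ⟨i, hi, j, hj, h⟩
  · rintro ⟨i, hi, j, hj, h⟩
    exact ⟨i, j, h, hi, hj⟩

/-- **`W_{b-a} Hom(H₁, H₂) = Hom(H₁, H₂)` when `W_{a-1} H₁ = 0` and `W_b H₂ = H₂`**: `Hom(weights ≥ a, weights ≤ b)` has weights `≤ b - a`.
[cite: DeligneHodgeII1971, 1.1.12] [cite: CattaniElZeinGriffithsLe2014, §3.2.2.7] -/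
theorem hom_W_eq_top_of {a b : ℤ} (ha : H₁.W (a - 1) = ⊥) (hb : H₂.W b = ⊤) : (hom H₁ H₂).W (b - a) = ⊤ := by
  refine weightsLE_iff.1 (weightsLE_of_forall_isWeight fun n hn => ?_)
  obtain ⟨i, j, hij, hi, hj⟩ := (isWeight_hom_iff H₁ H₂ n).1 hn
  have hi' : a - 1 < i := lt_of_not_ge fun h => not_isWeight_of_W_eq_bot ha h hi
  have hj' := (weightsLE_iff.2 hb).le_of_isWeight hj
  omega

/-- **`W_{b-a-1} Hom(H₁, H₂) = 0` when `W_a H₁ = H₁` and `W_{b-1} H₂ = 0`**: `Hom(weights ≤ a, weights ≥ b)` has weights `≥ b - a`.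
[cite: DeligneHodgeII1971, 1.1.12] [cite: CattaniElZeinGriffithsLe2014, §3.2.2.7] -/
theorem hom_W_eq_bot_of {a b : ℤ} (ha : H₁.W a = ⊤) (hb : H₂.W (b - 1) = ⊥) : (hom H₁ H₂).W (b - a - 1) = ⊥ := by
  refine MixedHodgeStructureCat.W_eq_bot_of_forall_isWeight_lt (X := MixedHodgeStructureCat.of (hom H₁ H₂)) fun n hn => ?_
  obtain ⟨i, j, hij, hi, hj⟩ := (isWeight_hom_iff H₁ H₂ n).1 hn
  have hi' := (weightsLE_iff.2 ha).le_of_isWeight hi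
  have hj' : b - 1 < j := lt_of_not_ge fun h => not_isWeight_of_W_eq_bot hb h hj
  omega

end MixedHodgeStructure

/-! ## §2 The rules for `weightsIn S` (bundled) -/

namespace MixedHodgeStructureCat

variable {S T : Set ℤ}

/-- **`X ∈ weightsIn S`, `Y ∈ weightsIn T ⟹ X ⊗ Y ∈ weightsIn (S + T)`** (Minkowski sum).
[cite: DeligneHodgeII1971, 1.1.12] [cite: CattaniElZeinGriffithsLe2014, §3.2.2.7] -/
theorem weightsIn_tensor {X Y : MixedHodgeStructureCat.{u}} [Module.Finite ℚ X] [Module.Finite ℚ Y] (hX : weightsIn S X) (hY : weightsIn T Y) :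
    weightsIn (S + T) (of (X.str.tensor Y.str)) := fun n hn => by
  obtain ⟨i, j, h, hi, hj⟩ := (MixedHodgeStructure.isWeight_tensor_iff X.str Y.str n).1 hn
  exact Set.mem_add.2 ⟨i, hX hi, j, hY hj, h⟩

/-- The set of weights of `X ⊗ Y` is the sum of the sets of weights: `X ⊗ Y ∈ weightsIn U ↔ S_X + S_Y ⊆ U`.
[cite: DeligneHodgeII1971, 1.1.12] -/
theorem weightsIn_tensor_iff {X Y : MixedHodgeStructureCat.{u}} [Module.Finite ℚ X] [Module.Finite ℚ Y] (U : Set ℤ) :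
    weightsIn U (of (X.str.tensor Y.str)) ↔ {i | X.str.IsWeight i} + {j | Y.str.IsWeight j} ⊆ U := by
  rw [weightsIn_iff_setOf_isWeight_subset]
  exact Iff.of_eq (congrArg (· ⊆ U) (MixedHodgeStructure.setOf_isWeight_tensor X.str Y.str))

/-- **Weights `≤ a` ⊗ weights `≤ b` ⊆ weights `≤ a + b`.** [cite: DeligneHodgeII1971, 1.1.12] [cite: CattaniElZeinGriffithsLe2014, §3.2.2.7] -/
theorem weightsIn_Iic_tensor {a b : ℤ} {X Y : MixedHodgeStructureCat.{u}} [Module.Finite ℚ X] [Module.Finite ℚ Y]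
    (hX : weightsIn (Set.Iic a) X) (hY : weightsIn (Set.Iic b) Y) : weightsIn (Set.Iic (a + b)) (of (X.str.tensor Y.str)) :=
  weightsIn_of_subset (by
    rintro _ ⟨i, hi, j, hj, rfl⟩
    exact Set.mem_Iic.2 (add_le_add (Set.mem_Iic.1 hi) (Set.mem_Iic.1 hj))) (weightsIn_tensor hX hY)

/-- **Weights `≥ a` ⊗ weights `≥ b` ⊆ weights `≥ a + b`.** [cite: DeligneHodgeII1971, 1.1.12] [cite: CattaniElZeinGriffithsLe2014, §3.2.2.7] -/
theorem weightsIn_Ici_tensor {a b : ℤ} {X Y : MixedHodgeStructureCat.{u}} [Module.Finite ℚ X] [Module.Finite ℚ Y]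
    (hX : weightsIn (Set.Ici a) X) (hY : weightsIn (Set.Ici b) Y) : weightsIn (Set.Ici (a + b)) (of (X.str.tensor Y.str)) :=
  weightsIn_of_subset (by
    rintro _ ⟨i, hi, j, hj, rfl⟩
    exact Set.mem_Ici.2 (add_le_add (Set.mem_Ici.1 hi) (Set.mem_Ici.1 hj))) (weightsIn_tensor hX hY)

/-- **Weights in `[a, b]` ⊗ weights in `[c, d]` ⊆ weights in `[a + c, b + d]`.** [cite: DeligneHodgeII1971, 1.1.12] -/
theorem weightsIn_Icc_tensor {a b c d : ℤ} {X Y : MixedHodgeStructureCat.{u}} [Module.Finite ℚ X] [Module.Finite ℚ Y]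
    (hX : weightsIn (Set.Icc a b) X) (hY : weightsIn (Set.Icc c d) Y) : weightsIn (Set.Icc (a + c) (b + d)) (of (X.str.tensor Y.str)) :=
  weightsIn_of_subset (Set.Icc_add_Icc_subset a b c d) (weightsIn_tensor hX hY)

/-- **Pure of weight `n` ⊗ pure of weight `m` is pure of weight `n + m`** (in the `weightsIn` language; the tree's `IsPure.tensor`).
[cite: CattaniElZeinGriffithsLe2014, §3.2.2.7] -/
theorem weightsIn_singleton_tensor {n m : ℤ} {X Y : MixedHodgeStructureCat.{u}} [Module.Finite ℚ X] [Module.Finite ℚ Y]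
    (hX : weightsIn {n} X) (hY : weightsIn {m} Y) : weightsIn {n + m} (of (X.str.tensor Y.str)) :=
  weightsIn_of_subset (by rw [Set.singleton_add_singleton]) (weightsIn_tensor hX hY)

/-- **`X^∨ ∈ weightsIn S ↔ X ∈ weightsIn (-S)`** (the weights of the dual are the negatives). [cite: Fujiki1980, (1.6.2) a)] -/
theorem weightsIn_dual_iff (S : Set ℤ) (X : MixedHodgeStructureCat.{u}) [Module.Finite ℚ X] : weightsIn S (of X.str.dual) ↔ weightsIn (-S) X := by
  rw [weightsIn_iff_setOf_isWeight_subset, weightsIn_iff_setOf_isWeight_subset]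
  change {k | X.str.dual.IsWeight k} ⊆ S ↔ _
  rw [MixedHodgeStructure.setOf_isWeight_dual, Set.neg_subset]

/-- `X^∨` has weights `≤ a` iff `X` has weights `≥ -a`. [cite: Fujiki1980, (1.6.2) a)] -/
theorem weightsIn_Iic_dual_iff (a : ℤ) (X : MixedHodgeStructureCat.{u}) [Module.Finite ℚ X] :
    weightsIn (Set.Iic a) (of X.str.dual) ↔ weightsIn (Set.Ici (-a)) X := by
  rw [weightsIn_dual_iff, Set.neg_Iic]

/-- `X^∨` has weights `≥ a` iff `X` has weights `≤ -a`. [cite: Fujiki1980, (1.6.2) a)] -/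
theorem weightsIn_Ici_dual_iff (a : ℤ) (X : MixedHodgeStructureCat.{u}) [Module.Finite ℚ X] :
    weightsIn (Set.Ici a) (of X.str.dual) ↔ weightsIn (Set.Iic (-a)) X := by
  rw [weightsIn_dual_iff, Set.neg_Ici]

/-- `X^∨` is pure of weight `n` iff `X` is pure of weight `-n` (the tree's `isPure_dual_iff`, in the `weightsIn` language). [cite: Fujiki1980, (1.6.2) a)] -/
theorem weightsIn_singleton_dual_iff (n : ℤ) (X : MixedHodgeStructureCat.{u}) [Module.Finite ℚ X] :
    weightsIn {n} (of X.str.dual) ↔ weightsIn {-n} X := by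
  rw [weightsIn_dual_iff, Set.neg_singleton]

/-- **`X ∈ weightsIn S`, `Y ∈ weightsIn T ⟹ Hom(X, Y) ∈ weightsIn {j - i | i ∈ S, j ∈ T}`.**
[cite: DeligneHodgeII1971, 1.1.12] [cite: CattaniElZeinGriffithsLe2014, §3.2.2.7] -/
theorem weightsIn_hom {X Y : MixedHodgeStructureCat.{u}} [Module.Finite ℚ X] [Module.Finite ℚ Y] (hX : weightsIn S X) (hY : weightsIn T Y) :
    weightsIn (Set.image2 (fun i j => j - i) S T) (of (X.str.hom Y.str)) := fun n hn => by
  obtain ⟨i, j, h, hi, hj⟩ := (MixedHodgeStructure.isWeight_hom_iff X.str Y.str n).1 hn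
  exact Set.mem_image2.2 ⟨i, hX hi, j, hY hj, h⟩

/-- **`Hom(weights ≥ a, weights ≤ b)` has weights `≤ b - a`.** [cite: DeligneHodgeII1971, 1.1.12] [cite: CattaniElZeinGriffithsLe2014, §3.2.2.7] -/
theorem weightsIn_Iic_hom {a b : ℤ} {X Y : MixedHodgeStructureCat.{u}} [Module.Finite ℚ X] [Module.Finite ℚ Y]
    (hX : weightsIn (Set.Ici a) X) (hY : weightsIn (Set.Iic b) Y) : weightsIn (Set.Iic (b - a)) (of (X.str.hom Y.str)) :=
  weightsIn_of_subset (by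
    rintro _ ⟨i, hi, j, hj, rfl⟩
    have hi := Set.mem_Ici.1 hi
    have hj := Set.mem_Iic.1 hj
    exact Set.mem_Iic.2 (show j - i ≤ b - a by omega)) (weightsIn_hom hX hY)

/-- **`Hom(weights ≤ a, weights ≥ b)` has weights `≥ b - a`.** [cite: DeligneHodgeII1971, 1.1.12] [cite: CattaniElZeinGriffithsLe2014, §3.2.2.7] -/
theorem weightsIn_Ici_hom {a b : ℤ} {X Y : MixedHodgeStructureCat.{u}} [Module.Finite ℚ X] [Module.Finite ℚ Y]
    (hX : weightsIn (Set.Iic a) X) (hY : weightsIn (Set.Ici b) Y) : weightsIn (Set.Ici (b - a)) (of (X.str.hom Y.str)) :=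
  weightsIn_of_subset (by
    rintro _ ⟨i, hi, j, hj, rfl⟩
    have hi := Set.mem_Iic.1 hi
    have hj := Set.mem_Ici.1 hj
    exact Set.mem_Ici.2 (show b - a ≤ j - i by omega)) (weightsIn_hom hX hY)

/-- **`Hom(weights in [a, b], weights in [c, d])` has weights in `[c - b, d - a]`.** [cite: DeligneHodgeII1971, 1.1.12] -/
theorem weightsIn_Icc_hom {a b c d : ℤ} {X Y : MixedHodgeStructureCat.{u}} [Module.Finite ℚ X] [Module.Finite ℚ Y]
    (hX : weightsIn (Set.Icc a b) X) (hY : weightsIn (Set.Icc c d) Y) : weightsIn (Set.Icc (c - b) (d - a)) (of (X.str.hom Y.str)) :=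
  weightsIn_of_subset (by
    rintro _ ⟨i, hi, j, hj, rfl⟩
    obtain ⟨hi1, hi2⟩ := Set.mem_Icc.1 hi
    obtain ⟨hj1, hj2⟩ := Set.mem_Icc.1 hj
    exact Set.mem_Icc.2 ⟨show c - b ≤ j - i by omega, show j - i ≤ d - a by omega⟩) (weightsIn_hom hX hY)

/-- **`Hom(pure of weight n, pure of weight m)` is pure of weight `m - n`** (the tree's `IsPure.hom`, in the `weightsIn` language).
[cite: CattaniElZeinGriffithsLe2014, §3.2.2.7] -/
theorem weightsIn_singleton_hom {n m : ℤ} {X Y : MixedHodgeStructureCat.{u}} [Module.Finite ℚ X] [Module.Finite ℚ Y]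
    (hX : weightsIn {n} X) (hY : weightsIn {m} Y) : weightsIn {m - n} (of (X.str.hom Y.str)) :=
  weightsIn_of_subset (by
    rintro _ ⟨i, hi, j, hj, rfl⟩
    rw [Set.mem_singleton_iff.1 hi, Set.mem_singleton_iff.1 hj]
    exact Set.mem_singleton _) (weightsIn_hom hX hY)

/-- **`X(j) ∈ weightsIn S ↔ X ∈ weightsIn {m | m - 2j ∈ S}`** (the Tate twist `X(j)` has weight `k` iff `X` has weight `k + 2j`).
[cite: CattaniElZeinGriffithsLe2014, Ex. 3.2.23 (4)] -/
theorem weightsIn_tateTwist_obj_iff (S : Set ℤ) (j : ℤ) (X : MixedHodgeStructureCat.{u}) :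
    weightsIn S ((tateTwist j).obj X) ↔ weightsIn ((fun m => m - 2 * j) ⁻¹' S) X := by
  constructor
  · intro h m hm
    exact Set.mem_preimage.2 (h ((isWeight_tateTwist_obj_iff j (m - 2 * j) X).2 (by rwa [sub_add_cancel])))
  · intro h k hk
    have := h ((isWeight_tateTwist_obj_iff j k X).1 hk)
    rwa [Set.mem_preimage, add_sub_cancel_right] at this

/-- `X(j)` has weights `≤ a` iff `X` has weights `≤ a + 2j`. [cite: CattaniElZeinGriffithsLe2014, Ex. 3.2.23 (4)] -/
theorem weightsIn_Iic_tateTwist_obj_iff (a j : ℤ) (X : MixedHodgeStructureCat.{u}) :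
    weightsIn (Set.Iic a) ((tateTwist j).obj X) ↔ weightsIn (Set.Iic (a + 2 * j)) X := by
  rw [weightsIn_tateTwist_obj_iff]
  exact Iff.of_eq (congrArg (fun U => weightsIn U X) (Set.ext fun m => by simp only [Set.mem_preimage, Set.mem_Iic]; omega))

/-- `X(j)` has weights `≥ a` iff `X` has weights `≥ a + 2j`. [cite: CattaniElZeinGriffithsLe2014, Ex. 3.2.23 (4)] -/
theorem weightsIn_Ici_tateTwist_obj_iff (a j : ℤ) (X : MixedHodgeStructureCat.{u}) :
    weightsIn (Set.Ici a) ((tateTwist j).obj X) ↔ weightsIn (Set.Ici (a + 2 * j)) X := by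
  rw [weightsIn_tateTwist_obj_iff]
  exact Iff.of_eq (congrArg (fun U => weightsIn U X) (Set.ext fun m => by simp only [Set.mem_preimage, Set.mem_Ici]; omega))

/-- `X(j)` is pure of weight `n` iff `X` is pure of weight `n + 2j` («its `m`-twist is an HS of weight `n − 2m`»).
[cite: CattaniElZeinGriffithsLe2014, Ex. 3.1.5 and Ex. 3.2.23 (4)] -/
theorem weightsIn_singleton_tateTwist_obj_iff (n j : ℤ) (X : MixedHodgeStructureCat.{u}) :
    weightsIn {n} ((tateTwist j).obj X) ↔ weightsIn {n + 2 * j} X := by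
  rw [weightsIn_tateTwist_obj_iff]
  exact Iff.of_eq (congrArg (fun U => weightsIn U X)
    (Set.ext fun m => by simp only [Set.mem_preimage, Set.mem_singleton_iff]; omega))

/-- The Tate object `ℚ(j) ⊗ X` pattern: twisting shifts interval weights, `X ∈ weightsIn (Icc a b) ↔ X(j) ∈ weightsIn (Icc (a - 2j) (b - 2j))`.
[cite: CattaniElZeinGriffithsLe2014, Ex. 3.2.23 (4)] -/
theorem weightsIn_Icc_tateTwist_obj_iff (a b j : ℤ) (X : MixedHodgeStructureCat.{u}) :
    weightsIn (Set.Icc a b) ((tateTwist j).obj X) ↔ weightsIn (Set.Icc (a + 2 * j) (b + 2 * j)) X := by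
  rw [weightsIn_tateTwist_obj_iff]
  exact Iff.of_eq (congrArg (fun U => weightsIn U X) (Set.ext fun m => by simp only [Set.mem_preimage, Set.mem_Icc]; omega))

end MixedHodgeStructureCat

end Literature.AlgebraicGeometry.Motives

end
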